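import Literature.Analysis.FluidPDE.PassiveVectorFourier
import HarnessLib

/-!
# Superposition of weak passive-vector solutions on `T^d` and orthogonality of frequency-disjoint fields

Analysis/FluidPDE proof-support file (everything proved; no new definitions, no named facts). For the
weak class `Torus.IsWeakPassiveVectorOn A T ν b w₀ w` of `PassiveVector.lean` (the LINEAR passive-vector
family `∂ₜw + (b·∇)w + A (w·∇)b + ∇π = νΔw`, `∇·w = 0` of Yoshida–Kaneda 2000, eq. (4)–(5), in the weak
form of DiPerna–Lions 1989 §II.1 tested against divergence-free fields):

* §1 **superposition**: the sum of two weak solutions with the same carrier, coupling and viscosity is a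
  weak solution for the sum of the (integrable) data (`IsWeakPassiveVectorOn.add`), constant multiples
  (`IsWeakPassiveVectorOn.const_smul`), finite sums (`IsWeakPassiveVectorOn.finset_sum`) — linearity
  of the weak formulation; the bookkeeping clauses (`L^∞_t L²_x`, `‖b‖‖w‖ ∈ L¹`, weak
  divergence-freeness) are closed under sums;
* §2 **orthogonality of frequency-disjoint `L²` vector fields**: if for every `k ∈ ℤ^d` one of
  `𝓕(complexify ∘ v)(k)`, `𝓕(complexify ∘ w)(k)` vanishes then `∫⟪v, w⟫ = 0`
  (`integral_inner_eq_zero_of_mFourierCoeff_disjoint`, Parseval for inner products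
  `hasSum_re_inner_mFourierCoeff_complexify`), and the energies of a finite frequency-disjoint family add
  up: `∫‖∑ᵢ vᵢ‖² = ∑ᵢ ∫‖vᵢ‖²` (`integral_norm_sq_finset_sum_eq_of_mFourierCoeff_disjoint`).

These are the two glue facts of the Bloch (Floquet–Bloch sector) decomposition of the passive solenoidal
vector around a `1/n`-periodic carrier: data split into finitely many frequency classes `ℓ + nℤ^d`, each
class evolves on its own, solutions are summed and energies are read off class by class
(Bensoussan–Lions–Papanicolaou 1978, Ch. 4 §3 (Bloch expansion); here only the superposition and the
orthogonality, not the sector invariance, which is a property of the constructed solutions).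

## Mathlib / tree search

Tree: `PassiveVectorClass` (class API: `integrable_weakIntegrand`, `ae_memLp_two`, `exists_eLpNorm_le`,
`aestronglyMeasurable_uncurry(_carrier)`, `lintegral_mul_lt_top`), `PassiveVectorUniqueness.sub_of_eq`
(the difference with EQUAL data — the template of `add`), `TorusVectorParseval`
(`hasSum_re_inner_mFourierCoeff_complexify`), `TorusFourierModes.integrable_inner_of_continuous`.
No additivity / superposition lemma for `IsWeakPassiveVectorOn` with different data existed (2026-08-27).

## References

* K. Yoshida, Y. Kaneda, Phys. Rev. E 63 (2000) 016308, §II eq. (4)–(5). [`YoshidaKaneda2000`]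
* R. J. DiPerna, P.-L. Lions, Invent. Math. 98 (1989) 511–547, §II.1 (12)–(14). [`DiPernaLions1989`]
* A. Bensoussan, J.-L. Lions, G. Papanicolaou, *Asymptotic Analysis for Periodic Structures*,
  North-Holland 1978, Ch. 4 §3 (Bloch waves) — context only, no statement of it is used here.
* L. Grafakos, *Classical Fourier Analysis*, 3rd ed. (2014), Prop. 3.2.7 (3). [`Grafakos2014`]
-/

noncomputable section

open MeasureTheory TopologicalSpace Set Function Filter Topology UnitAddTorus
open scoped ENNReal NNReal InnerProductSpace

namespace Literature.Analysis.FluidPDE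

namespace Torus

variable {d : Type*} [Fintype d] [DecidableEq d]

/-! ## §1 Superposition in the weak passive-vector class -/

section Superposition

namespace IsWeakPassiveVectorOn

variable {A T ν : ℝ} {b u v : ℝ → UnitAddTorus d → EuclideanSpace ℝ d}
  {u₀ v₀ : UnitAddTorus d → EuclideanSpace ℝ d}

/-- `‖b‖ ‖u + v‖ ∈ L¹((0,T) × T^d)` for two weak solutions with the same carrier
(iterated-`lintegral` form of the class). [cite: DiPernaLions1989, §II.1 (12)–(14)] -/
theorem lintegral_mul_add_lt_top (h₁ : IsWeakPassiveVectorOn A T ν b u₀ u)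
    (h₂ : IsWeakPassiveVectorOn A T ν b v₀ v) :
    ∫⁻ t in Ioo 0 T, ∫⁻ x, ‖b t x‖ₑ * ‖u t x + v t x‖ₑ < ⊤ := by
  set μT : Measure ℝ := (volume : Measure ℝ).restrict (Ioo 0 T) with hμT
  have hmu := h₁.aestronglyMeasurable_uncurry_carrier
  have hm₁ := h₁.aestronglyMeasurable_uncurry
  have hm₂ := h₂.aestronglyMeasurable_uncurry
  have hF : AEMeasurable (fun p : ℝ × UnitAddTorus d => ‖b p.1 p.2‖ₑ * ‖u p.1 p.2 + v p.1 p.2‖ₑ)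
      (μT.prod volume) := hmu.enorm.mul (hm₁.add hm₂).enorm
  have hF₁ : AEMeasurable (fun p : ℝ × UnitAddTorus d => ‖b p.1 p.2‖ₑ * ‖u p.1 p.2‖ₑ) (μT.prod volume) :=
    hmu.enorm.mul hm₁.enorm
  have hF₂ : AEMeasurable (fun p : ℝ × UnitAddTorus d => ‖b p.1 p.2‖ₑ * ‖v p.1 p.2‖ₑ) (μT.prod volume) :=
    hmu.enorm.mul hm₂.enorm
  have e : ∫⁻ t in Ioo 0 T, ∫⁻ x, ‖b t x‖ₑ * ‖u t x + v t x‖ₑ =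
      ∫⁻ p, ‖b p.1 p.2‖ₑ * ‖u p.1 p.2 + v p.1 p.2‖ₑ ∂(μT.prod volume) := (lintegral_prod _ hF).symm
  rw [e]
  calc ∫⁻ p, ‖b p.1 p.2‖ₑ * ‖u p.1 p.2 + v p.1 p.2‖ₑ ∂(μT.prod volume)
      ≤ ∫⁻ p, (‖b p.1 p.2‖ₑ * ‖u p.1 p.2‖ₑ + ‖b p.1 p.2‖ₑ * ‖v p.1 p.2‖ₑ) ∂(μT.prod volume) := by
        refine lintegral_mono fun p => ?_
        rw [← mul_add]
        gcongr
        exact enorm_add_le _ _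
    _ = (∫⁻ p, ‖b p.1 p.2‖ₑ * ‖u p.1 p.2‖ₑ ∂(μT.prod volume)) +
          ∫⁻ p, ‖b p.1 p.2‖ₑ * ‖v p.1 p.2‖ₑ ∂(μT.prod volume) := lintegral_add_left' hF₁ _
    _ = (∫⁻ t in Ioo 0 T, ∫⁻ x, ‖b t x‖ₑ * ‖u t x‖ₑ) + ∫⁻ t in Ioo 0 T, ∫⁻ x, ‖b t x‖ₑ * ‖v t x‖ₑ := by
        rw [lintegral_prod _ hF₁, lintegral_prod _ hF₂]
    _ < ⊤ := ENNReal.add_lt_top.2 ⟨h₁.lintegral_mul_lt_top, h₂.lintegral_mul_lt_top⟩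

/-- `u + v ∈ L^∞(0,T; L²)`: `∫ ‖u(t) + v(t)‖² ≤ (C₁ + C₂)²` for a.e. `t`. [cite: DiPernaLions1989, §II.1 (12)–(14)] -/
theorem ae_lintegral_sq_add_le (h₁ : IsWeakPassiveVectorOn A T ν b u₀ u)
    (h₂ : IsWeakPassiveVectorOn A T ν b v₀ v) :
    ∃ C : ℝ≥0, ∀ᵐ t ∂(volume.restrict (Ioo 0 T)), ∫⁻ x, ‖u t x + v t x‖ₑ ^ 2 ≤ C := by
  obtain ⟨C₁, hC₁⟩ := h₁.exists_eLpNorm_le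
  obtain ⟨C₂, hC₂⟩ := h₂.exists_eLpNorm_le
  refine ⟨(C₁ + C₂) ^ 2, ?_⟩
  filter_upwards [hC₁, hC₂, h₁.ae_memLp_two, h₂.ae_memLp_two] with t hc₁ hc₂ hm₁ hm₂
  have hadd : eLpNorm (u t + v t) 2 volume ≤ C₁ + C₂ :=
    (eLpNorm_add_le hm₁.1 hm₂.1 one_le_two).trans (add_le_add hc₁ hc₂)
  have e : ∫⁻ x, ‖u t x + v t x‖ₑ ^ 2 = eLpNorm (u t + v t) 2 volume ^ 2 := by
    rw [eLpNorm_eq_lintegral_rpow_enorm_toReal two_ne_zero ENNReal.ofNat_ne_top, ENNReal.toReal_ofNat,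
      ← ENNReal.rpow_natCast, ← ENNReal.rpow_mul]
    norm_num
  rw [e, ENNReal.coe_pow, ENNReal.coe_add]
  exact pow_le_pow_left' hadd 2

omit [DecidableEq d] in
/-- Sums of integrable weakly divergence-free fields are weakly divergence free (the space `H` of
Temam, Ch. I §1.4, is a linear space). [cite: Temam1984, Ch. I §1.4 (the space H)] -/
theorem _root_.Literature.Analysis.FunctionSpaces.Torus.IsWeaklyDivFree.add_of_integrable
    {u₁ u₂ : UnitAddTorus d → EuclideanSpace ℝ d}
    (h₁ : FunctionSpaces.Torus.IsWeaklyDivFree u₁) (h₂ : FunctionSpaces.Torus.IsWeaklyDivFree u₂)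
    (hu₁ : Integrable u₁ volume) (hu₂ : Integrable u₂ volume) :
    FunctionSpaces.Torus.IsWeaklyDivFree (fun x => u₁ x + u₂ x) := by
  intro θ hθ
  simp_rw [inner_add_left]
  rw [integral_add (FunctionSpaces.Torus.integrable_inner_of_continuous hu₁ hθ.gradient.continuous)
    (FunctionSpaces.Torus.integrable_inner_of_continuous hu₂ hθ.gradient.continuous), h₁ θ hθ, h₂ θ hθ, add_zero]

omit [DecidableEq d] in
/-- Constant multiples of weakly divergence-free fields are weakly divergence free (the space `H` of
Temam, Ch. I §1.4, is a linear space). [cite: Temam1984, Ch. I §1.4 (the space H)] -/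
theorem _root_.Literature.Analysis.FunctionSpaces.Torus.IsWeaklyDivFree.const_smul'
    {u₁ : UnitAddTorus d → EuclideanSpace ℝ d}
    (h₁ : FunctionSpaces.Torus.IsWeaklyDivFree u₁) (c : ℝ) :
    FunctionSpaces.Torus.IsWeaklyDivFree (fun x => c • u₁ x) := by
  intro θ hθ
  simp_rw [real_inner_smul_left]
  rw [integral_const_mul, h₁ θ hθ, mul_zero]

/-- **Superposition (additivity) of weak passive-vector solutions.** If `u`, `v` are weak solutions
of `∂ₜw + (b·∇)w + A (w·∇)b + ∇π = νΔw`, `∇·w = 0` on `T^d × [0,T)` with the same carrier `b`,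
coupling `A` and viscosity `ν`, from integrable data `u₀`, `v₀`, then `u + v` is a weak solution from
`u₀ + v₀`: the weak formulation (Yoshida–Kaneda 2000 (4)–(5) tested against divergence-free fields,
DiPerna–Lions 1989 §II.1) is linear in the pair (datum, solution), and the bookkeeping clauses are closed
under sums (`lintegral_mul_add_lt_top`, `ae_lintegral_sq_add_le`). Integrability of the data is needed to
split the datum pairing `∫⟪u₀ + v₀, Ψ(0)⟫`. [cite: DiPernaLions1989, §II.1 (12)–(14)] -/
theorem add (h₁ : IsWeakPassiveVectorOn A T ν b u₀ u) (h₂ : IsWeakPassiveVectorOn A T ν b v₀ v)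
    (hu₀ : Integrable u₀ volume) (hv₀ : Integrable v₀ volume) :
    IsWeakPassiveVectorOn A T ν b (fun x => u₀ x + v₀ x) (fun t x => u t x + v t x) where
  aestronglyMeasurable := h₁.aestronglyMeasurable.add h₂.aestronglyMeasurable
  aestronglyMeasurable_carrier := h₁.aestronglyMeasurable_carrier
  ae_lintegral_sq_le := ae_lintegral_sq_add_le h₁ h₂
  lintegral_carrier_lt_top := h₁.lintegral_carrier_lt_top
  lintegral_mul_lt_top := lintegral_mul_add_lt_top h₁ h₂
  ae_isWeaklyDivFree_carrier := h₁.ae_isWeaklyDivFree_carrier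
  ae_isWeaklyDivFree := by
    filter_upwards [h₁.ae_isWeaklyDivFree, h₂.ae_isWeaklyDivFree, h₁.ae_memLp_two, h₂.ae_memLp_two]
      with t hd₁ hd₂ hm₁ hm₂
    exact hd₁.add_of_integrable hd₂ (hm₁.integrable one_le_two) (hm₂.integrable one_le_two)
  weak_eq Ψ hΨ hΨdiv := by
    have e₁ := h₁.weak_eq Ψ hΨ hΨdiv
    have e₂ := h₂.weak_eq Ψ hΨ hΨdiv
    have hI₁ := h₁.integrable_weakIntegrand hΨ
    have hI₂ := h₂.integrable_weakIntegrand hΨ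
    have hpt : ∀ t x, ⟪u t x + v t x, FunctionSpaces.Torus.timeDeriv Ψ t x +
          FunctionSpaces.Torus.convect (b t) (Ψ t) x + ν • FunctionSpaces.Torus.laplacian (Ψ t) x⟫_ℝ +
        A * ⟪b t x, FunctionSpaces.Torus.convect (fun y => u t y + v t y) (Ψ t) x⟫_ℝ =
        (⟪u t x, FunctionSpaces.Torus.timeDeriv Ψ t x +
            FunctionSpaces.Torus.convect (b t) (Ψ t) x + ν • FunctionSpaces.Torus.laplacian (Ψ t) x⟫_ℝ +
          A * ⟪b t x, FunctionSpaces.Torus.convect (u t) (Ψ t) x⟫_ℝ) +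
        (⟪v t x, FunctionSpaces.Torus.timeDeriv Ψ t x +
            FunctionSpaces.Torus.convect (b t) (Ψ t) x + ν • FunctionSpaces.Torus.laplacian (Ψ t) x⟫_ℝ +
          A * ⟪b t x, FunctionSpaces.Torus.convect (v t) (Ψ t) x⟫_ℝ) := by
      intro t x
      simp only [FunctionSpaces.Torus.convect, map_add, inner_add_left, inner_add_right]
      ring
    have hslice : ∀ᵐ t ∂(volume.restrict (Ioo 0 T)),
        ∫ x, (⟪u t x + v t x, FunctionSpaces.Torus.timeDeriv Ψ t x +
            FunctionSpaces.Torus.convect (b t) (Ψ t) x + ν • FunctionSpaces.Torus.laplacian (Ψ t) x⟫_ℝ +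
          A * ⟪b t x, FunctionSpaces.Torus.convect (fun y => u t y + v t y) (Ψ t) x⟫_ℝ) =
        (∫ x, (⟪u t x, FunctionSpaces.Torus.timeDeriv Ψ t x +
            FunctionSpaces.Torus.convect (b t) (Ψ t) x + ν • FunctionSpaces.Torus.laplacian (Ψ t) x⟫_ℝ +
          A * ⟪b t x, FunctionSpaces.Torus.convect (u t) (Ψ t) x⟫_ℝ)) +
        ∫ x, (⟪v t x, FunctionSpaces.Torus.timeDeriv Ψ t x +
            FunctionSpaces.Torus.convect (b t) (Ψ t) x + ν • FunctionSpaces.Torus.laplacian (Ψ t) x⟫_ℝ +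
          A * ⟪b t x, FunctionSpaces.Torus.convect (v t) (Ψ t) x⟫_ℝ) := by
      filter_upwards [hI₁.prod_right_ae, hI₂.prod_right_ae] with t ht₁ ht₂
      rw [← integral_add ht₁ ht₂]
      exact integral_congr_ae (Eventually.of_forall fun x => hpt t x)
    -- the datum pairing splits: `Ψ 0` is continuous and the data are integrable
    have hΨ0 : Continuous (Ψ 0) := (hΨ.isSmooth_slice 0).continuous
    have hd : ∫ x, ⟪u₀ x + v₀ x, Ψ 0 x⟫_ℝ = (∫ x, ⟪u₀ x, Ψ 0 x⟫_ℝ) + ∫ x, ⟪v₀ x, Ψ 0 x⟫_ℝ := by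
      simp_rw [inner_add_left]
      exact integral_add (FunctionSpaces.Torus.integrable_inner_of_continuous hu₀ hΨ0)
        (FunctionSpaces.Torus.integrable_inner_of_continuous hv₀ hΨ0)
    rw [integral_congr_ae hslice, integral_add hI₁.integral_prod_left hI₂.integral_prod_left, hd]
    linarith

/-- **Constant multiples of weak passive-vector solutions** are weak solutions for the multiplied
datum (linearity of Yoshida–Kaneda (4)–(5) in weak form). [cite: DiPernaLions1989, §II.1 (12)–(14)] -/
theorem const_smul (h₁ : IsWeakPassiveVectorOn A T ν b u₀ u) (c : ℝ) :
    IsWeakPassiveVectorOn A T ν b (fun x => c • u₀ x) (fun t x => c • u t x) where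
  aestronglyMeasurable := h₁.aestronglyMeasurable.const_smul c
  aestronglyMeasurable_carrier := h₁.aestronglyMeasurable_carrier
  ae_lintegral_sq_le := by
    obtain ⟨C, hC⟩ := h₁.ae_lintegral_sq_le
    refine ⟨‖c‖₊ ^ 2 * C, ?_⟩
    filter_upwards [hC] with t ht
    have e : ∫⁻ x, ‖c • u t x‖ₑ ^ 2 = (‖c‖₊ : ℝ≥0∞) ^ 2 * ∫⁻ x, ‖u t x‖ₑ ^ 2 := by
      rw [← lintegral_const_mul' _ _ (by simp)]
      refine lintegral_congr fun x => ?_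
      rw [enorm_smul, mul_pow]
      rfl
    rw [e, ENNReal.coe_mul, ENNReal.coe_pow]
    gcongr
  lintegral_carrier_lt_top := h₁.lintegral_carrier_lt_top
  lintegral_mul_lt_top := by
    have e : ∫⁻ t in Ioo 0 T, ∫⁻ x, ‖b t x‖ₑ * ‖c • u t x‖ₑ =
        (‖c‖₊ : ℝ≥0∞) * ∫⁻ t in Ioo 0 T, ∫⁻ x, ‖b t x‖ₑ * ‖u t x‖ₑ := by
      rw [← lintegral_const_mul' _ _ (by simp)]
      refine lintegral_congr fun t => ?_
      rw [← lintegral_const_mul' _ _ (by simp)]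
      refine lintegral_congr fun x => ?_
      rw [enorm_smul]
      simp only [mul_left_comm]
      rfl
    rw [e]
    exact ENNReal.mul_lt_top (by simp) h₁.lintegral_mul_lt_top
  ae_isWeaklyDivFree_carrier := h₁.ae_isWeaklyDivFree_carrier
  ae_isWeaklyDivFree := by
    filter_upwards [h₁.ae_isWeaklyDivFree] with t hd₁
    exact hd₁.const_smul' c
  weak_eq Ψ hΨ hΨdiv := by
    have e₁ := h₁.weak_eq Ψ hΨ hΨdiv
    have hI₁ := h₁.integrable_weakIntegrand hΨ
    have hpt : ∀ t x, ⟪c • u t x, FunctionSpaces.Torus.timeDeriv Ψ t x +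
          FunctionSpaces.Torus.convect (b t) (Ψ t) x + ν • FunctionSpaces.Torus.laplacian (Ψ t) x⟫_ℝ +
        A * ⟪b t x, FunctionSpaces.Torus.convect (fun y => c • u t y) (Ψ t) x⟫_ℝ =
        c * (⟪u t x, FunctionSpaces.Torus.timeDeriv Ψ t x +
            FunctionSpaces.Torus.convect (b t) (Ψ t) x + ν • FunctionSpaces.Torus.laplacian (Ψ t) x⟫_ℝ +
          A * ⟪b t x, FunctionSpaces.Torus.convect (u t) (Ψ t) x⟫_ℝ) := by
      intro t x
      simp only [FunctionSpaces.Torus.convect, map_smul, real_inner_smul_left, real_inner_smul_right]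
      ring
    have hslice : ∀ᵐ t ∂(volume.restrict (Ioo 0 T)),
        ∫ x, (⟪c • u t x, FunctionSpaces.Torus.timeDeriv Ψ t x +
            FunctionSpaces.Torus.convect (b t) (Ψ t) x + ν • FunctionSpaces.Torus.laplacian (Ψ t) x⟫_ℝ +
          A * ⟪b t x, FunctionSpaces.Torus.convect (fun y => c • u t y) (Ψ t) x⟫_ℝ) =
        c * ∫ x, (⟪u t x, FunctionSpaces.Torus.timeDeriv Ψ t x +
            FunctionSpaces.Torus.convect (b t) (Ψ t) x + ν • FunctionSpaces.Torus.laplacian (Ψ t) x⟫_ℝ +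
          A * ⟪b t x, FunctionSpaces.Torus.convect (u t) (Ψ t) x⟫_ℝ) := by
      filter_upwards with t
      rw [← integral_const_mul]
      exact integral_congr_ae (Eventually.of_forall fun x => hpt t x)
    have hd : ∫ x, ⟪c • u₀ x, Ψ 0 x⟫_ℝ = c * ∫ x, ⟪u₀ x, Ψ 0 x⟫_ℝ := by
      simp_rw [real_inner_smul_left]
      exact integral_const_mul _ _
    rw [integral_congr_ae hslice, integral_const_mul, hd, ← mul_add, e₁, mul_zero]

/-- **Finite superposition of weak passive-vector solutions**: for a non-empty finite family of weak
solutions `u i` from integrable data `u₀ i` (same carrier, coupling, viscosity), `∑ᵢ u i` is a weak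
solution from `∑ᵢ u₀ i`. (Non-emptiness: the class records the carrier's bookkeeping, which an empty sum
would have to supply by itself.) [cite: DiPernaLions1989, §II.1 (12)–(14)] -/
theorem finset_sum {ι : Type*} (s : Finset ι) (hs : s.Nonempty)
    {U₀ : ι → UnitAddTorus d → EuclideanSpace ℝ d} {U : ι → ℝ → UnitAddTorus d → EuclideanSpace ℝ d}
    (hint : ∀ i ∈ s, Integrable (U₀ i) volume) (h : ∀ i ∈ s, IsWeakPassiveVectorOn A T ν b (U₀ i) (U i)) :
    IsWeakPassiveVectorOn A T ν b (fun x => ∑ i ∈ s, U₀ i x) (fun t x => ∑ i ∈ s, U i t x) := by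
  classical
  induction hs using Finset.Nonempty.cons_induction with
  | singleton a =>
    simp only [Finset.sum_singleton]
    exact h a (Finset.mem_singleton_self a)
  | cons a s ha hs ih =>
    simp only [Finset.sum_cons]
    have hint' : ∀ i ∈ s, Integrable (U₀ i) volume := fun i hi => hint i (Finset.mem_cons_of_mem hi)
    have h' : ∀ i ∈ s, IsWeakPassiveVectorOn A T ν b (U₀ i) (U i) := fun i hi => h i (Finset.mem_cons_of_mem hi)
    have hsumint : Integrable (fun x => ∑ i ∈ s, U₀ i x) volume :=
      integrable_finsetSum s fun i hi => hint' i hi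
    exact (h a (Finset.mem_cons_self a s)).add (ih hint' h') (hint a (Finset.mem_cons_self a s)) hsumint

end IsWeakPassiveVectorOn

end Superposition

/-! ## §2 Orthogonality of frequency-disjoint `L²` vector fields -/

section Orthogonality

omit [DecidableEq d] in
/-- `⟪f, g⟫` is integrable for `f, g ∈ L²` (Cauchy–Schwarz; local copy, to keep the import closure
small). [folklore] -/
private theorem integrable_inner_memLp_two_aux {f g : UnitAddTorus d → EuclideanSpace ℝ d}
    (hf : MemLp f 2 volume) (hg : MemLp g 2 volume) :
    Integrable (fun x => ⟪f x, g x⟫_ℝ) volume := by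
  have h : MemLp ((fun x => ‖g x‖) * fun x => ‖f x‖) 1 volume := hf.norm.mul hg.norm
  refine (memLp_one_iff_integrable.1 h).mono' (hf.1.inner hg.1) (Eventually.of_forall fun x => ?_)
  rw [Pi.mul_apply, Real.norm_eq_abs, mul_comm]
  exact abs_real_inner_le_norm _ _

omit [DecidableEq d] in
/-- **Frequency-disjoint `L²` vector fields are orthogonal**: if for every `k ∈ ℤ^d` one of
`𝓕(complexify ∘ v)(k)`, `𝓕(complexify ∘ w)(k)` is zero, then `∫⟪v, w⟫ = 0` — every term of the
Parseval series `∫⟪v, w⟫ = ∑ₖ Re ⟪𝓕v(k), 𝓕w(k)⟫` (Grafakos, Prop. 3.2.7 (3)) vanishes. [cite: Grafakos2014, Prop. 3.2.7 (3)] -/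
theorem integral_inner_eq_zero_of_mFourierCoeff_disjoint {v w : UnitAddTorus d → EuclideanSpace ℝ d}
    (hv : MemLp v 2 volume) (hw : MemLp w 2 volume)
    (h : ∀ k : d → ℤ, mFourierCoeff (FunctionSpaces.EuclideanSpace.complexify ∘ v) k = 0 ∨
      mFourierCoeff (FunctionSpaces.EuclideanSpace.complexify ∘ w) k = 0) :
    ∫ x, ⟪v x, w x⟫_ℝ = 0 := by
  have hs := FunctionSpaces.Torus.hasSum_re_inner_mFourierCoeff_complexify hv hw
  have h0 : ∀ k : d → ℤ, (inner ℂ (mFourierCoeff (FunctionSpaces.EuclideanSpace.complexify ∘ v) k)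
      (mFourierCoeff (FunctionSpaces.EuclideanSpace.complexify ∘ w) k)).re = 0 := by
    intro k
    rcases h k with hk | hk <;> simp [hk]
  simp_rw [h0] at hs
  exact (hasSum_zero.unique hs).symm

omit [DecidableEq d] in
/-- **Energies of a finite frequency-disjoint family add up**: for `L²` fields `v i`, `i ∈ s`, whose
Fourier supports are pairwise disjoint, `∫‖∑_{i∈s} v i‖² = ∑_{i∈s} ∫‖v i‖²` (Pythagoras in `L²(T^d; ℝ^d)`,
the cross pairings vanishing by `integral_inner_eq_zero_of_mFourierCoeff_disjoint`). [cite: Grafakos2014, Prop. 3.2.7 (3)] -/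
theorem integral_norm_sq_finset_sum_eq_of_mFourierCoeff_disjoint {ι : Type*} (s : Finset ι)
    {v : ι → UnitAddTorus d → EuclideanSpace ℝ d} (hv : ∀ i ∈ s, MemLp (v i) 2 volume)
    (h : ∀ i ∈ s, ∀ j ∈ s, i ≠ j → ∀ k : d → ℤ,
      mFourierCoeff (FunctionSpaces.EuclideanSpace.complexify ∘ v i) k = 0 ∨
        mFourierCoeff (FunctionSpaces.EuclideanSpace.complexify ∘ v j) k = 0) :
    ∫ x, ‖∑ i ∈ s, v i x‖ ^ 2 = ∑ i ∈ s, ∫ x, ‖v i x‖ ^ 2 := by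
  classical
  induction s using Finset.induction_on with
  | empty => simp
  | insert a s ha ih =>
    have hva : MemLp (v a) 2 volume := hv a (Finset.mem_insert_self a s)
    have hv' : ∀ i ∈ s, MemLp (v i) 2 volume := fun i hi => hv i (Finset.mem_insert_of_mem hi)
    have h' : ∀ i ∈ s, ∀ j ∈ s, i ≠ j → ∀ k : d → ℤ,
        mFourierCoeff (FunctionSpaces.EuclideanSpace.complexify ∘ v i) k = 0 ∨
          mFourierCoeff (FunctionSpaces.EuclideanSpace.complexify ∘ v j) k = 0 :=
      fun i hi j hj hij => h i (Finset.mem_insert_of_mem hi) j (Finset.mem_insert_of_mem hj) hij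
    have hS : MemLp (fun x => ∑ i ∈ s, v i x) 2 volume := memLp_finsetSum s fun i hi => hv' i hi
    -- the cross pairing vanishes term by term
    have hcross : ∫ x, ⟪v a x, ∑ i ∈ s, v i x⟫_ℝ = 0 := by
      simp_rw [inner_sum]
      rw [integral_finsetSum s fun i hi => integrable_inner_memLp_two_aux hva (hv' i hi)]
      refine Finset.sum_eq_zero fun i hi => ?_
      have hai : a ≠ i := fun e => ha (e ▸ hi)
      exact integral_inner_eq_zero_of_mFourierCoeff_disjoint hva (hv' i hi)
        (h a (Finset.mem_insert_self a s) i (Finset.mem_insert_of_mem hi) hai)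
    simp_rw [Finset.sum_insert ha]
    rw [← ih hv' h']
    -- expand `‖v a + S‖² = ‖v a‖² + 2⟪v a, S⟫ + ‖S‖²`
    have hexp : ∀ x, ‖v a x + ∑ i ∈ s, v i x‖ ^ 2 =
        ‖v a x‖ ^ 2 + 2 * ⟪v a x, ∑ i ∈ s, v i x⟫_ℝ + ‖∑ i ∈ s, v i x‖ ^ 2 := fun x =>
      norm_add_sq_real _ _
    simp_rw [hexp]
    have i1 : Integrable (fun x => ‖v a x‖ ^ 2) volume := hva.integrable_norm_pow two_ne_zero
    have i2 : Integrable (fun x => 2 * ⟪v a x, ∑ i ∈ s, v i x⟫_ℝ) volume :=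
      (integrable_inner_memLp_two_aux hva hS).const_mul 2
    have i3 : Integrable (fun x => ‖∑ i ∈ s, v i x‖ ^ 2) volume := hS.integrable_norm_pow two_ne_zero
    have e12 : ∫ x, (‖v a x‖ ^ 2 + 2 * ⟪v a x, ∑ i ∈ s, v i x⟫_ℝ) = ∫ x, ‖v a x‖ ^ 2 := by
      rw [integral_add i1 i2, integral_const_mul, hcross, mul_zero, add_zero]
    have i12 : Integrable (fun x => ‖v a x‖ ^ 2 + 2 * ⟪v a x, ∑ i ∈ s, v i x⟫_ℝ) volume := i1.add i2
    rw [integral_add i12 i3, e12]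

end Orthogonality

end Torus

end Literature.Analysis.FluidPDE

end
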